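import Summits.BirchSwinnertonDyer.Rank1Residual.Additive.KatoDescentKatoRigidGroupLike
import Literature.NumberTheory.EllipticCurves.PAdicPowerSeriesCharacterEvaluationProofs
import HarnessLib

set_option autoImplicit false

/-!
# AUG engine, step 10: the ANALYTIC BRIDGE — at a point `z` of the open unit disc of `ℂ_p` with `(1 + z)^{p^n} = 1`, the
# `ℂ_p`-value `Σ_k Φ_k z^k` of `Φ ∈ Λ = ℤ_p⟦T⟧` is the value `r(z)` of ANY polynomial representative `r ≡ Φ (mod ω_n)`
# (seat `bsd-cm-prr-ty1` g14, cell `bsd-cm`; theorems only: no definition, no named fact, no instance, no `sorry`)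

Part 52 of the seat's kernel cut of stub 3 (cruxes stmt-BirchSwinnertonDyer-19945 / -19223).  The seat's identities (★χ)
(E33/E35) and dictionary (E37/E38) evaluate Iwasawa functions through polynomial representatives modulo
`ω_n = (1 + T)^{p^n} − 1` (`aeval (u − 1) r`, purely algebraic, in `ℚ_p ⊗_ℚ ℂ` or — after E36's transport — in any
`ℚ_p`-algebra).  The successor's separation step uses the tree's ANALYTIC evaluation on the open unit disc of `ℂ_p`
(`PAdicPowerSeriesZeros`, `PAdicPowerSeriesCharacterEvaluationProofs`: `HasSum (k ↦ ι(Φ_k) z^k) v`,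
`MemIwasawaRat.eq_of_forall_hasSum`).  THIS FILE identifies the two at the character points:
* ★ `hasSum_coeff_of_sub_coe_mem_span` — for `Φ − ↑r ∈ (ω_n)` in `ℤ_p⟦T⟧`, `‖z‖ < 1` and `(z + 1)^{p^n} = 1`:
  `HasSum (k ↦ ι(Φ_k) z^k) (r.eval₂ ι z)` (`Φ = r + H·ω_n`, evaluation is additive and multiplicative on the disc
  (`hasSum_cpCoeff_mul`), `ω_n(z) = 0`);
* `hasSum_coeff_binomialSeries_of_pow_eq_one` — hence `(1 + T)^α` has the value `(z + 1)^a` at such `z` when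
  `p^n ∣ α − a` (E37 `binomialSeries_sub_pow_mem_span`), a parametrisation-free twin of the tree's
  `hasSum_cpCoeff_binomialSeries_character`.
HONEST LABEL: Iwasawa-algebra plumbing; AUG displayed; no stub closed; nothing asserted on 19945 / 19223; BSD is not proved for
any curve.
References: [LangCyclotomic1990] Ch. 4 §1 Thm. 1.2, Ch. 5 §1–§2; [Washington1997] §7.1–§7.2.
-/

noncomputable section

open PowerSeries
open Literature.NumberTheory.EllipticCurves

namespace Summit.BirchSwinnertonDyer.Rank1Residual.Additive.PerrinRiouUnit

variable {p : ℕ} [Fact p.Prime]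

/-- ★ **Analytic value = value of a representative** at `z` with `‖z‖ < 1`, `(z + 1)^{p^n} = 1`: for `Φ ≡ r (mod ω_n)` in
`ℤ_p⟦T⟧`, `Σ_k ι(Φ_k) z^k = r(z)` (`ι : ℤ_p → ℚ_p → ℂ_p`). [cite: LangCyclotomic1990, Ch. 4 §1 Thm. 1.2 and Ch. 5 §2] -/
theorem hasSum_coeff_of_sub_coe_mem_span {Φ : PowerSeries ℤ_[p]} {r : Polynomial ℤ_[p]} {n : ℕ}
    (hr : Φ - (r : PowerSeries ℤ_[p]) ∈
      Ideal.span {(((Polynomial.X + 1 : Polynomial ℤ_[p]) ^ p ^ n - 1 : Polynomial ℤ_[p]) : PowerSeries ℤ_[p])})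
    {z : ℂ_[p]} (hz : ‖z‖ < 1) (hzn : (z + 1) ^ p ^ n = 1) :
    HasSum (fun k ↦ ((algebraMap ℚ_[p] ℂ_[p]).comp (algebraMap ℤ_[p] ℚ_[p])) (coeff k Φ) * z ^ k)
      (r.eval₂ ((algebraMap ℚ_[p] ℂ_[p]).comp (algebraMap ℤ_[p] ℚ_[p])) z) := by
  set ι := (algebraMap ℚ_[p] ℂ_[p]).comp (algebraMap ℤ_[p] ℚ_[p]) with hι
  set ω : Polynomial ℤ_[p] := (Polynomial.X + 1 : Polynomial ℤ_[p]) ^ p ^ n - 1 with hω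
  obtain ⟨H, hH⟩ := Ideal.mem_span_singleton'.mp hr
  have hΦ : Φ = (r : PowerSeries ℤ_[p]) + H * (ω : PowerSeries ℤ_[p]) := by rw [hH]; ring
  have h_r := hasSum_map_coeff_coe_mul_pow ι r z
  have h_ω := hasSum_map_coeff_coe_mul_pow ι ω z
  have hω0 : ω.eval₂ ι z = 0 := by
    rw [hω, Polynomial.eval₂_sub, Polynomial.eval₂_pow, Polynomial.eval₂_add, Polynomial.eval₂_X, Polynomial.eval₂_one,
      hzn, sub_self]
  rw [hω0] at h_ω
  have h_H := (summable_map_coeff_mul_pow ι (norm_algebraMap_coeff_le_one H) hz).hasSum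
  have h_Hω := hasSum_cpCoeff_mul hz h_H h_ω
  rw [mul_zero] at h_Hω
  have h := h_r.add h_Hω
  rw [add_zero] at h
  convert h using 1
  funext k
  rw [hΦ, map_add, map_add, add_mul]

/-- **`(1 + T)^α` has the analytic value `(z + 1)^a`** at `z` (`‖z‖ < 1`, `(z + 1)^{p^n} = 1`) when `p^n ∣ α − a`.
[cite: Washington1997, §7.2] [cite: LangCyclotomic1990, Ch. 4 §1] -/
theorem hasSum_coeff_binomialSeries_of_pow_eq_one (α : ℤ_[p]) {a n : ℕ} (h : ((p : ℤ_[p]) ^ n) ∣ α - a)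
    {z : ℂ_[p]} (hz : ‖z‖ < 1) (hzn : (z + 1) ^ p ^ n = 1) :
    HasSum (fun k ↦ ((algebraMap ℚ_[p] ℂ_[p]).comp (algebraMap ℤ_[p] ℚ_[p])) (coeff k (binomialSeries ℤ_[p] α)) * z ^ k)
      ((z + 1) ^ a) := by
  have hb := hasSum_coeff_of_sub_coe_mem_span (binomialSeries_sub_pow_mem_span α a n h) hz hzn
  rwa [Polynomial.eval₂_pow, Polynomial.eval₂_add, Polynomial.eval₂_X, Polynomial.eval₂_one] at hb

end Summit.BirchSwinnertonDyer.Rank1Residual.Additive.PerrinRiouUnit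

end
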